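import Summits.AtomisticToContinuum.BoseEinsteinCondensation.Theses.BECStronglyRayleigh
import Summits.AtomisticToContinuum.BoseEinsteinCondensation.Theorems.BECStronglyRayleighGroundStateStability
import Summits.AtomisticToContinuum.BoseEinsteinCondensation.Theorems.BECStronglyRayleighSectorGroundStatePerron
import Summits.AtomisticToContinuum.BoseEinsteinCondensation.Theorems.BECStronglyRayleighInsertionFieldDelocalisationAmplitudePos
import Summits.AtomisticToContinuum.BoseEinsteinCondensation.Theorems.InsertionFieldDelocalisation.Negative.PerronExistence
import Literature.Combinatorics.StablePolynomials.NegativeLatticeCondition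
import Literature.MathematicalPhysics.QuantumLattice.LiebRobinsonHastingsKomaSpectralProofs
import HarnessLib

/-!
# Stub `stub_convexity` (STUB 1) of line `mobile-trap-dirichlet-eigenfunction`, crux
# `BECStronglyRayleigh.InsertionFieldDelocalisation` (stmt-AtomisticToContinuum-9673)

**Convexity of the sector ground energies of the hard-core Bose gas on `(ℤ/Lℤ)³` in the particle
number**: `2E(N) ≤ E(N+1) + E(N-1)` for `1 ≤ N`, `N + 1 ≤ L³`, where
`E(k) = lowestEnergyInSector 1 (xyTorus 3 L 1) (k - L³/2)` (sector of `k` bosons = weight `L³ - k`;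
occupied = spin up = `Fin`-index `0`, `1_S = fun z => if z ∈ S then 0 else 1`). Proof:
1. STABILITY OF `e^{-τH}𝟙`: the landed engine of Theorem S (`stub_trotterClosure` ∘ `stub_eulerLimit`
   ∘ `stub_eulerGate`, `stub_siteFactor`, at `Δ = 0`, `μ = 0`) makes `W_τ = e^{-τH}` preserve
   upper-half-plane stability of occupation polynomials; `𝟙` has occupation polynomial
   `Π_i (1 + z_i)`. So the REAL NONNEGATIVE family `A_τ(S) := (W_τ𝟙)(1_S)` (`W_τ` is entrywise a
   nonnegative real matrix) has a stable generating polynomial.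
2. NLC with constant one (`Literature.Combinatorics.StablePolynomials.multiAffine_negLatticeCondition`):
   `A_τ(T) A_τ(T ∪ {x,y}) ≤ A_τ(T ∪ x) A_τ(T ∪ y)` for `x ≠ y ∉ T`.
3. TWO-SIDED PERRON BOUNDS at fixed `τ`: a Perron vector `ψ_n ≥ 0` of the `n`-boson sector
   (`exists_nonneg_sectorGroundState_xyTorus`) is strictly positive on `n`-sets and
   `W_τ ψ_n = e^{-τE(n)} ψ_n` (`exp_smul_mulVec_of_mulVec_eq`); with `m_n := Σ_σ ψ_n(σ)`,
   `W_τ ≥ 0` entrywise gives `e^{-τE(n)} ψ_n(1_S) ≤ m_n A_τ(S)` and symmetry of `W_τ` gives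
   `ψ_n(1_S) A_τ(S) ≤ Σ_σ ψ_n(σ)(W_τ𝟙)(σ) = e^{-τE(n)} m_n`.
4. For `|T| = N - 1`, `x ≠ y ∉ T` and all `τ > 0`: `e^{-τ(E(N-1)+E(N+1))} c ≤ A_τ(T)A_τ(T∪xy)
   ≤ A_τ(T∪x)A_τ(T∪y) ≤ e^{-2τE(N)} b` with `τ`-independent `b, c > 0`; let `τ → ∞`.
-/

noncomputable section

namespace Summit.AtomisticToContinuum.BoseEinsteinCondensation.Cruxes.InsertionFieldDelocalisation.MobileTrapDirichletEigenfunction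

open scoped BigOperators ComplexOrder
open Literature.MathematicalPhysics.QuantumLattice Literature.Probability.LatticeModels
open Summit.AtomisticToContinuum.BoseEinsteinCondensation.Theorems.InsertionFieldDelocalisation.Negative
  (exists_nonneg_sectorGroundState_xyTorus card_torusSite weight_ind star_xxzZero_apply
    re_xxzZero_apply_nonpos xxzZero_isHermitian)
open Summit.AtomisticToContinuum.BoseEinsteinCondensation.Cruxes.GroundStateStability.StableConeVariationalSelection
  (stub_trotterClosure stub_eulerGate stub_eulerLimit stub_siteFactor gibbsStr_exp_entry_nonneg
    leadPF_entries)
open Matrix Finset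

/-! ### Elementary real-analysis glue -/

/-- If `exp(τ δ) ≤ K` for every `τ > 0` then `δ ≤ 0`; here `δ = 2eN - eP - eM`. [folklore] -/
theorem mt1cv_conclude {eN eP eM K : ℝ}
    (h : ∀ τ : ℝ, 0 < τ → Real.exp (τ * (2 * eN - eP - eM)) ≤ K) : 2 * eN ≤ eP + eM := by
  by_contra hcon
  have hδ0 : 0 < 2 * eN - eP - eM := by linarith
  have hτ : 0 < (|K| + 1) / (2 * eN - eP - eM) := div_pos (by positivity) hδ0
  have h1 := h _ hτ
  rw [div_mul_cancel₀ _ hδ0.ne'] at h1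
  have h3 := Real.add_one_le_exp (|K| + 1)
  linarith [le_abs_self K]

/-- The sandwich at fixed `τ`: lower Perron bounds on `a_T, a_U`, the negative lattice condition
`a_T a_U ≤ a_X a_Y` and upper Perron bounds on `a_X, a_Y` give `exp(τ(2eN - eP - eM)) ≤ b₁b₂/(c₁c₂)`.
[folklore] -/
theorem mt1cv_sandwich {τ eN eP eM aT aU aX aY c₁ c₂ b₁ b₂ : ℝ}
    (hT0 : 0 ≤ aT) (hX0 : 0 ≤ aX) (hY0 : 0 ≤ aY) (hnlc : aT * aU ≤ aX * aY)
    (hT : Real.exp (-(τ * eM)) * c₁ ≤ aT) (hU : Real.exp (-(τ * eP)) * c₂ ≤ aU)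
    (hX : aX ≤ Real.exp (-(τ * eN)) * b₁) (hY : aY ≤ Real.exp (-(τ * eN)) * b₂)
    (hc₁ : 0 < c₁) (hc₂ : 0 < c₂) :
    Real.exp (τ * (2 * eN - eP - eM)) ≤ b₁ * b₂ / (c₁ * c₂) := by
  have h1 : Real.exp (-(τ * eM)) * c₁ * (Real.exp (-(τ * eP)) * c₂) ≤ aT * aU :=
    mul_le_mul hT hU (by positivity) hT0
  have h2 : aX * aY ≤ Real.exp (-(τ * eN)) * b₁ * (Real.exp (-(τ * eN)) * b₂) :=
    mul_le_mul hX hY hY0 (hX0.trans hX)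
  have h3 := h1.trans (hnlc.trans h2)
  have hv : 0 < Real.exp (-(τ * eN)) * Real.exp (-(τ * eN)) := by positivity
  have hkey : Real.exp (τ * (2 * eN - eP - eM)) =
      Real.exp (-(τ * eM)) * Real.exp (-(τ * eP)) / (Real.exp (-(τ * eN)) * Real.exp (-(τ * eN))) := by
    rw [eq_div_iff hv.ne', ← Real.exp_add, ← Real.exp_add, ← Real.exp_add]
    congr 1
    ring
  rw [hkey, div_le_div_iff₀ hv (mul_pos hc₁ hc₂)]
  nlinarith [h3]

/-! ### Abstract Perron bounds for an entrywise nonnegative real matrix -/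

section Abstract

variable {ι : Type*} [Fintype ι]

omit [Fintype ι] in
/-- Entrywise nonnegative (complex order) entries are real. [folklore] -/
theorem mt1cv_star_entry {W : Matrix ι ι ℂ} (hW : ∀ i j, (0 : ℂ) ≤ W i j) :
    ∀ i j, star (W i j) = W i j := fun i j =>
  Complex.conj_eq_iff_im.mpr (Complex.nonneg_iff.mp (hW i j)).2.symm

/-- `(W𝟙)_k = Σ_j Re W_kj` for an entrywise nonnegative real matrix. [folklore] -/
theorem mt1cv_re_mulVec_one {W : Matrix ι ι ℂ} (hW : ∀ i j, (0 : ℂ) ≤ W i j) (k : ι) :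
    ((W *ᵥ fun _ => (1 : ℂ)) k).re = ∑ j, (W k j).re := by
  rw [PerronFrobenius.re_mulVec_apply (mt1cv_star_entry hW)]
  simp only [Complex.one_re, mul_one]

/-- `(W𝟙)_k` is a nonnegative real for an entrywise nonnegative real matrix. [folklore] -/
theorem mt1cv_mulVec_one_nonneg {W : Matrix ι ι ℂ} (hW : ∀ i j, (0 : ℂ) ≤ W i j) (k : ι) :
    0 ≤ ((W *ᵥ fun _ => (1 : ℂ)) k).re ∧ ((W *ᵥ fun _ => (1 : ℂ)) k).im = 0 := by
  have h : (0 : ℂ) ≤ (W *ᵥ fun _ => (1 : ℂ)) k := by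
    rw [mulVec, dotProduct]
    exact Finset.sum_nonneg fun j _ => mul_nonneg (hW k j) zero_le_one
  rw [Complex.nonneg_iff] at h
  exact ⟨h.1, h.2.symm⟩

/-- **Lower Perron bound.** If `W ≥ 0` entrywise, `ψ ≥ 0` and `Wψ = rψ`, then
`r ψ_i ≤ (Σ_j ψ_j) (W𝟙)_i` (apply `W ≥ 0` to `(Σψ)𝟙 - ψ ≥ 0`). [folklore] -/
theorem mt1cv_lower {W : Matrix ι ι ℂ} (hW : ∀ i j, (0 : ℂ) ≤ W i j) {ψ : ι → ℂ}
    (hnn : ∀ i, 0 ≤ (ψ i).re ∧ (ψ i).im = 0) {r : ℝ} (hWψ : W *ᵥ ψ = ((r : ℝ) : ℂ) • ψ)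
    (i : ι) : r * (ψ i).re ≤ (∑ j, (ψ j).re) * ((W *ᵥ fun _ => (1 : ℂ)) i).re := by
  have hreal := mt1cv_star_entry hW
  have h1 : r * (ψ i).re = ∑ j, (W i j).re * (ψ j).re := by
    rw [← PerronFrobenius.re_mulVec_apply hreal, hWψ, Pi.smul_apply, smul_eq_mul,
      Complex.re_ofReal_mul]
  rw [h1, mt1cv_re_mulVec_one hW, Finset.mul_sum]
  refine Finset.sum_le_sum fun j _ => ?_
  rw [mul_comm]
  exact mul_le_mul_of_nonneg_right
    (Finset.single_le_sum (f := fun k => (ψ k).re) (fun k _ => (hnn k).1) (Finset.mem_univ j))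
    (Complex.nonneg_iff.mp (hW i j)).1

/-- **Upper Perron bound.** If `W ≥ 0` entrywise is symmetric, `ψ ≥ 0` and `Wψ = rψ`, then
`ψ_i (W𝟙)_i ≤ Σ_k ψ_k (W𝟙)_k = ⟨W ψ, 𝟙⟩ = r Σ_j ψ_j`. [folklore] -/
theorem mt1cv_upper {W : Matrix ι ι ℂ} (hW : ∀ i j, (0 : ℂ) ≤ W i j)
    (hsymm : ∀ i j, W i j = W j i) {ψ : ι → ℂ} (hnn : ∀ i, 0 ≤ (ψ i).re ∧ (ψ i).im = 0) {r : ℝ}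
    (hWψ : W *ᵥ ψ = ((r : ℝ) : ℂ) • ψ) (i : ι) :
    (ψ i).re * ((W *ᵥ fun _ => (1 : ℂ)) i).re ≤ r * ∑ j, (ψ j).re := by
  have hreal := mt1cv_star_entry hW
  have heig : ∀ k, ∑ j, (W k j).re * (ψ j).re = r * (ψ k).re := fun k => by
    rw [← PerronFrobenius.re_mulVec_apply hreal, hWψ, Pi.smul_apply, smul_eq_mul,
      Complex.re_ofReal_mul]
  have hsum : ∑ k, (ψ k).re * ((W *ᵥ fun _ => (1 : ℂ)) k).re = r * ∑ j, (ψ j).re := by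
    simp_rw [mt1cv_re_mulVec_one hW, Finset.mul_sum]
    rw [Finset.sum_comm]
    refine Finset.sum_congr rfl fun j _ => ?_
    rw [← heig j]
    refine Finset.sum_congr rfl fun k _ => ?_
    rw [hsymm j k, mul_comm]
  rw [← hsum]
  exact Finset.single_le_sum (f := fun k => (ψ k).re * ((W *ᵥ fun _ => (1 : ℂ)) k).re)
    (fun k _ => mul_nonneg (hnn k).1 (mt1cv_mulVec_one_nonneg hW k).1) (Finset.mem_univ i)

end Abstract

/-! ### The Gibbs weight of the XY torus: entries, symmetry, stability of `e^{-τH}𝟙` -/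

/-- The Gibbs weight `e^{-τH}`, `τ ≥ 0`, of the `Δ = 0`, `J = -1` XXZ Hamiltonian is entrywise a
nonnegative real matrix (`-τH` is real with nonnegative off-diagonal entries). [folklore] -/
theorem mt1cv_gibbs_entry_nonneg {Λ : Type*} [Fintype Λ] [DecidableEq Λ] (G : SimpleGraph Λ)
    [DecidableRel G.Adj] {τ : ℝ} (hτ : 0 ≤ τ) :
    ∀ i j, (0 : ℂ) ≤ Matrix.gibbsWeight τ (xxzHamiltonian 1 G (-1) 0) i j := by
  have him : ∀ i j, (xxzHamiltonian 1 G (-1) 0 i j).im = 0 := fun i j =>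
    Complex.conj_eq_iff_im.mp (star_xxzZero_apply G (-1) i j)
  rw [Matrix.gibbsWeight]
  refine gibbsStr_exp_entry_nonneg _ (fun i j => ?_) (fun i j hij => ?_)
  · rw [Matrix.smul_apply, smul_eq_mul, Complex.mul_im, Complex.neg_re, Complex.neg_im,
      Complex.ofReal_re, Complex.ofReal_im, him, neg_zero, mul_zero, zero_mul, add_zero]
  · have h1 := re_xxzZero_apply_nonpos G (show (-1 : ℝ) ≤ 0 by norm_num) hij
    rw [Matrix.smul_apply, smul_eq_mul, Complex.mul_re, Complex.neg_re, Complex.neg_im,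
      Complex.ofReal_re, Complex.ofReal_im, him, neg_zero, mul_zero, sub_zero]
    nlinarith

/-- The Gibbs weight of the `Δ = 0` XXZ Hamiltonian is a symmetric matrix (Hermitian with real
entries). [folklore] -/
theorem mt1cv_gibbs_symm {Λ : Type*} [Fintype Λ] [DecidableEq Λ] (G : SimpleGraph Λ)
    [DecidableRel G.Adj] {τ : ℝ} (hτ : 0 ≤ τ) :
    ∀ i j, Matrix.gibbsWeight τ (xxzHamiltonian 1 G (-1) 0) i j =
      Matrix.gibbsWeight τ (xxzHamiltonian 1 G (-1) 0) j i := by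
  intro i j
  have hH := Matrix.isHermitian_gibbsWeight τ (xxzZero_isHermitian G (-1))
  rw [← hH.apply i j]
  exact mt1cv_star_entry (mt1cv_gibbs_entry_nonneg G hτ) j i

/-- **`C⁺` at `Δ = 0`, `μ = 0`** (the landed engine of Theorem S): for `τ ≥ 0` the Gibbs weight
of `xxzHamiltonian 1 G (-1) 0` maps vectors with upper-half-plane stable occupation polynomial to
such vectors. [folklore] -/
theorem mt1cv_semigroup (Λ : Type) [Fintype Λ] [DecidableEq Λ] (G : SimpleGraph Λ)
    [DecidableRel G.Adj] (τ : ℝ) (hτ : 0 ≤ τ) (φ : TensorIndex Λ 2 → ℂ)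
    (hφ : ∀ z : Λ → ℂ, (∀ i, 0 < (z i).im) →
      (∑ S : Finset Λ, φ (fun i => if i ∈ S then 0 else 1) * ∏ i ∈ S, z i) ≠ 0) :
    ∀ z : Λ → ℂ, (∀ i, 0 < (z i).im) →
      (∑ S : Finset Λ, (Matrix.gibbsWeight τ (xxzHamiltonian 1 G (-1) 0) *ᵥ φ)
        (fun i => if i ∈ S then 0 else 1) * ∏ i ∈ S, z i) ≠ 0 := by
  have hA := @stub_eulerGate
  have hB1 := @stub_eulerLimit
  have hbond : ∀ (Λ : Type) [Fintype Λ] [DecidableEq Λ] (x y : Λ), x ≠ y → ∀ (Δ t : ℝ), |Δ| ≤ 1 →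
      0 ≤ t → ∀ φ : TensorIndex Λ 2 → ℂ,
        (∀ z : Λ → ℂ, (∀ i, 0 < (z i).im) →
          (∑ S : Finset Λ, φ (fun i => if i ∈ S then 0 else 1) * ∏ i ∈ S, z i) ≠ 0) →
        (∀ z : Λ → ℂ, (∀ i, 0 < (z i).im) →
          (∑ S : Finset Λ, (NormedSpace.exp ((t : ℂ) • (spinBond 1 0 x y + spinBond 1 1 x y +
            (Δ : ℂ) • spinBond 1 2 x y)) *ᵥ φ) (fun i => if i ∈ S then 0 else 1) *
              ∏ i ∈ S, z i) ≠ 0) :=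
    fun Λ _ _ x y hxy Δ t hΔ ht φ hφ =>
      hB1 Λ _ (fun ε hε0 hε1 φ' hφ' => hA Λ x y hxy Δ ε hΔ hε0 hε1 φ' hφ') t ht φ hφ
  have hsemi := stub_trotterClosure hbond stub_siteFactor Λ G 0 (fun _ => (0 : ℝ))
    (by rw [abs_zero]; exact zero_le_one) τ hτ φ hφ
  simp only [Complex.ofReal_zero, zero_smul, Finset.sum_const_zero, add_zero] at hsemi
  exact hsemi

/-- The constant vector `𝟙` has occupation polynomial `Σ_S z^S = Π_i (1 + z_i)`, zero-free on
`H^Λ`. [folklore] -/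
theorem mt1cv_one_stable (Λ : Type) [Fintype Λ] [DecidableEq Λ] :
    ∀ z : Λ → ℂ, (∀ i, 0 < (z i).im) →
      (∑ S : Finset Λ, (fun _ : TensorIndex Λ 2 => (1 : ℂ)) (fun i => if i ∈ S then 0 else 1) *
        ∏ i ∈ S, z i) ≠ 0 := by
  intro z hz
  simp only [one_mul]
  rw [← Finset.powerset_univ, ← Finset.prod_one_add]
  refine Finset.prod_ne_zero_iff.mpr fun i _ h => ?_
  have h1 := congrArg Complex.im h
  rw [Complex.add_im, Complex.one_im, zero_add, Complex.zero_im] at h1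
  exact (hz i).ne' h1

/-- **Stability of `e^{-τH}𝟙` in NLC-ready form**: the real family `A_τ(S) = Re (e^{-τH}𝟙)(1_S)`
has a generating polynomial with no zero in `H^Λ`. [folklore] -/
theorem mt1cv_A_stable (Λ : Type) [Fintype Λ] [DecidableEq Λ] (G : SimpleGraph Λ)
    [DecidableRel G.Adj] (τ : ℝ) (hτ : 0 ≤ τ) :
    ∀ z : Λ → ℂ, (∀ i, 0 < (z i).im) →
      (∑ S : Finset Λ, ((((Matrix.gibbsWeight τ (xxzHamiltonian 1 G (-1) 0) *ᵥ
        fun _ => (1 : ℂ)) (fun i => if i ∈ S then 0 else 1)).re : ℝ) : ℂ) * ∏ i ∈ S, z i) ≠ 0 := by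
  intro z hz
  have h := mt1cv_semigroup Λ G τ hτ (fun _ => (1 : ℂ)) (mt1cv_one_stable Λ) z hz
  have hre : ∀ σ : TensorIndex Λ 2, ((((Matrix.gibbsWeight τ (xxzHamiltonian 1 G (-1) 0) *ᵥ
      fun _ => (1 : ℂ)) σ).re : ℝ) : ℂ) =
        (Matrix.gibbsWeight τ (xxzHamiltonian 1 G (-1) 0) *ᵥ fun _ => (1 : ℂ)) σ := fun σ =>
    Complex.ext (by rw [Complex.ofReal_re])
      (by rw [Complex.ofReal_im, (mt1cv_mulVec_one_nonneg (mt1cv_gibbs_entry_nonneg G hτ) σ).2])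
  simp_rw [hre]
  exact h

/-! ### Perron bounds in the sectors of the XY torus -/

/-- **Perron–Frobenius positivity in a sector of the XY torus**: a nonzero entrywise
real-nonnegative eigenvector of `xyTorus 3 L 1` lying in the sector of `n ≤ L³` bosons is strictly
positive on the occupation indicator of every `n`-set (`s2pos_sector_re_pos_of_nonneg`; adapted from
`stub_amplitudePos`). [folklore] -/
theorem mt1cv_pos (L : ℕ) [NeZero L] {n : ℕ} (hn : n ≤ L ^ 3)
    {ψ : TensorIndex (TorusSite 3 L) 2 → ℂ} (hψK : ψ ∈ spinZSector 1 ((n : ℝ) - (L : ℝ) ^ 3 / 2))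
    (hψ0 : ψ ≠ 0) {E : ℝ} (hHψ : (xyTorus 3 L 1) *ᵥ ψ = (E : ℂ) • ψ)
    (hnn : ∀ σ, 0 ≤ (ψ σ).re ∧ (ψ σ).im = 0) (S : Finset (TorusSite 3 L)) (hS : S.card = n) :
    0 < (ψ (fun x => if x ∈ S then 0 else 1)).re := by
  have hent := leadPF_entries (torusGraph 3 L) 0 (fun _ => (0 : ℝ))
  simp only [Complex.ofReal_zero, zero_smul, Finset.sum_const_zero, add_zero] at hent
  obtain ⟨happ, hreal, -, hoff, -⟩ := hent
  have hM : ((Fintype.card (TorusSite 3 L) * 1 : ℕ) : ℝ) / 2 - ((L ^ 3 - n : ℕ) : ℝ) =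
      (n : ℝ) - (L : ℝ) ^ 3 / 2 := by
    rw [card_torusSite, Nat.cast_sub hn]
    push_cast
    ring
  have hψW : ∀ σ : TensorIndex (TorusSite 3 L) 2, (∑ z, (σ z : ℕ)) ≠ L ^ 3 - n → ψ σ = 0 := by
    rw [← hM] at hψK
    exact (LiebMattis.mem_spinZSector_weight_iff 1 (L ^ 3 - n) ψ).1 hψK
  have hpos := LogInsertionInfraredBound.s2pos_sector_re_pos_of_nonneg (torusGraph 3 L)
    (Summit.AtomisticToContinuum.BoseEinsteinCondensation.Theorems.BECStronglyRayleighSectorPerron.torusGraph_connected 3 L)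
    (xyTorus 3 L 1) (fun σ τ hστ h h0 => h (neg_eq_zero.1 ((happ σ τ hστ).symm.trans h0)))
    hreal hoff (L ^ 3 - n) hψW hψ0 hHψ hnn
  refine hpos _ ?_
  rw [weight_ind S, Finset.card_compl, hS, card_torusSite]

/-- **Two-sided Perron bounds on `A_τ(S) = (e^{-τH}𝟙)(1_S)`** for an `n`-set `S`, `n ≤ L³`:
`e^{-τE(n)} c ≤ A_τ(S) ≤ e^{-τE(n)} b` for all `τ > 0`, with `τ`-independent `b, c > 0`
(`c = ψ_n(1_S)/Σψ_n`, `b = Σψ_n/ψ_n(1_S)` for a nonnegative Perron vector `ψ_n` of the sector).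
[folklore] -/
theorem mt1cv_twoSided (L : ℕ) [NeZero L] {n : ℕ} (hn : n ≤ L ^ 3) (S : Finset (TorusSite 3 L))
    (hS : S.card = n) :
    ∃ c b : ℝ, 0 < c ∧ 0 < b ∧ ∀ τ : ℝ, 0 < τ →
      Real.exp (-(τ * lowestEnergyInSector 1 (xyTorus 3 L 1) ((n : ℝ) - (L : ℝ) ^ 3 / 2))) * c ≤
          ((Matrix.gibbsWeight τ (xyTorus 3 L 1) *ᵥ fun _ => (1 : ℂ))
            (fun z => if z ∈ S then 0 else 1)).re ∧
        ((Matrix.gibbsWeight τ (xyTorus 3 L 1) *ᵥ fun _ => (1 : ℂ))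
            (fun z => if z ∈ S then 0 else 1)).re ≤
          Real.exp (-(τ * lowestEnergyInSector 1 (xyTorus 3 L 1) ((n : ℝ) - (L : ℝ) ^ 3 / 2))) * b := by
  obtain ⟨ψ, hψ0, hnn, hψK, hHψ⟩ := exists_nonneg_sectorGroundState_xyTorus 3 L n hn
  set E : ℝ := lowestEnergyInSector 1 (xyTorus 3 L 1) ((n : ℝ) - (L : ℝ) ^ 3 / 2)
  have hp : 0 < (ψ (fun x => if x ∈ S then 0 else 1)).re := mt1cv_pos L hn hψK hψ0 hHψ hnn S hS
  have hpm : (ψ (fun x => if x ∈ S then 0 else 1)).re ≤ ∑ σ, (ψ σ).re :=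
    Finset.single_le_sum (f := fun σ => (ψ σ).re) (fun σ _ => (hnn σ).1) (Finset.mem_univ _)
  have hm : 0 < ∑ σ, (ψ σ).re := hp.trans_le hpm
  refine ⟨(ψ (fun x => if x ∈ S then 0 else 1)).re / ∑ σ, (ψ σ).re,
    (∑ σ, (ψ σ).re) / (ψ (fun x => if x ∈ S then 0 else 1)).re, div_pos hp hm, div_pos hm hp,
    fun τ hτ => ?_⟩
  have hW := mt1cv_gibbs_entry_nonneg (torusGraph 3 L) hτ.le
  have hsymm := mt1cv_gibbs_symm (torusGraph 3 L) hτ.le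
  have hWψ : Matrix.gibbsWeight τ (xyTorus 3 L 1) *ᵥ ψ = ((Real.exp (-(τ * E)) : ℝ) : ℂ) • ψ := by
    rw [Matrix.gibbsWeight, exp_smul_mulVec_of_mulVec_eq (xyTorus 3 L 1) hHψ (-(τ : ℂ)),
      Complex.ofReal_exp]
    congr 2
    push_cast
    ring
  have hlow := mt1cv_lower hW hnn hWψ (fun x => if x ∈ S then 0 else 1)
  have hup := mt1cv_upper hW hsymm hnn hWψ (fun x => if x ∈ S then 0 else 1)
  constructor
  · rw [← mul_div_assoc, div_le_iff₀ hm]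
    linarith
  · rw [← mul_div_assoc, le_div_iff₀ hp]
    linarith

/-! ### The stub -/

/-- STUB 1 · `stub_convexity` — **convexity of the sector ground energies in the particle number**:
`2E(N) ≤ E(N+1) + E(N−1)` for `1 ≤ N`, `N + 1 ≤ L³`, `E(k) = lowestEnergyInSector 1 (xyTorus 3 L 1)
(k − L³/2)`. Stability of `e^{−τH}𝟙` (Theorem S engine) + negative lattice condition with constant
one (`multiAffine_negLatticeCondition`) + two-sided Perron bounds `A_τ(S) ≍ e^{−τE(|S|)}` + `τ → ∞`.
[folklore] -/
theorem stub_convexity :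
    ∀ (L : ℕ) [NeZero L], 2 ≤ L → ∀ N : ℕ, 1 ≤ N → N + 1 ≤ L ^ 3 →
      2 * lowestEnergyInSector 1 (xyTorus 3 L 1) ((N : ℝ) - (L : ℝ) ^ 3 / 2) ≤
        lowestEnergyInSector 1 (xyTorus 3 L 1) (((N + 1 : ℕ) : ℝ) - (L : ℝ) ^ 3 / 2) +
          lowestEnergyInSector 1 (xyTorus 3 L 1) (((N - 1 : ℕ) : ℝ) - (L : ℝ) ^ 3 / 2) := by
  intro L _ _hL N hN hNL
  -- an `(N+1)`-set `U = T ∪ {x, y}`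
  obtain ⟨U, -, hU⟩ : ∃ U ⊆ (Finset.univ : Finset (TorusSite 3 L)), U.card = N + 1 :=
    Finset.exists_subset_card_eq (by rw [Finset.card_univ, card_torusSite]; exact hNL)
  obtain ⟨x, hxU⟩ : U.Nonempty := by rw [← Finset.card_pos, hU]; omega
  obtain ⟨y, hyU⟩ : (U.erase x).Nonempty := by
    rw [← Finset.card_pos, Finset.card_erase_of_mem hxU, hU]; omega
  have hyx : y ≠ x := (Finset.mem_erase.mp hyU).1
  set T := (U.erase x).erase y with hTdef
  have hyT : y ∉ T := Finset.notMem_erase y _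
  have hxT : x ∉ T := fun h => (Finset.mem_erase.mp (Finset.mem_erase.mp h).2).1 rfl
  have hTy : insert y T = U.erase x := Finset.insert_erase hyU
  have hTxy : insert x (insert y T) = U := by rw [hTy, Finset.insert_erase hxU]
  have hcardT : T.card = N - 1 := by
    rw [hTdef, Finset.card_erase_of_mem hyU, Finset.card_erase_of_mem hxU, hU]
    omega
  have hcardTx : (insert x T).card = N := by
    rw [Finset.card_insert_of_notMem hxT, hcardT]; omega
  have hcardTy : (insert y T).card = N := by
    rw [Finset.card_insert_of_notMem hyT, hcardT]; omega
  have hcardU : (insert x (insert y T)).card = N + 1 := by rw [hTxy, hU]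
  -- two-sided Perron bounds for the four sets
  obtain ⟨c₁, _, hc₁, -, h₁⟩ := mt1cv_twoSided L (n := N - 1) (by omega) T hcardT
  obtain ⟨c₂, _, hc₂, -, h₂⟩ := mt1cv_twoSided L (n := N + 1) hNL _ hcardU
  obtain ⟨_, b₁, -, -, h₃⟩ := mt1cv_twoSided L (n := N) (by omega) _ hcardTx
  obtain ⟨_, b₂, -, -, h₄⟩ := mt1cv_twoSided L (n := N) (by omega) _ hcardTy
  refine mt1cv_conclude (K := b₁ * b₂ / (c₁ * c₂)) fun τ hτ => ?_
  have hW := mt1cv_gibbs_entry_nonneg (torusGraph 3 L) hτ.le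
  have hnlc := Literature.Combinatorics.StablePolynomials.multiAffine_negLatticeCondition
    (fun S : Finset (TorusSite 3 L) => ((Matrix.gibbsWeight τ (xyTorus 3 L 1) *ᵥ fun _ => (1 : ℂ))
      (fun z => if z ∈ S then 0 else 1)).re)
    (mt1cv_A_stable (TorusSite 3 L) (torusGraph 3 L) τ hτ.le) T hxT hyT hyx.symm
  exact mt1cv_sandwich (mt1cv_mulVec_one_nonneg hW _).1 (mt1cv_mulVec_one_nonneg hW _).1
    (mt1cv_mulVec_one_nonneg hW _).1 hnlc (h₁ τ hτ).1 (h₂ τ hτ).1 (h₃ τ hτ).2 (h₄ τ hτ).2 hc₁ hc₂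

end Summit.AtomisticToContinuum.BoseEinsteinCondensation.Cruxes.InsertionFieldDelocalisation.MobileTrapDirichletEigenfunction

end
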